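import Summits.ResolutionOfSingularities.ResolutionOfSingularities.Theorems.FrobeniusLadderFRationalResolutionSingBlowupRoofPullback
import Summits.ResolutionOfSingularities.ResolutionOfSingularities.Theorems.FrobeniusLadderFRationalResolutionRoofShrink
import Summits.ResolutionOfSingularities.ResolutionOfSingularities.Theorems.FrobeniusLadderFRationalResolutionFixedStratumBlowupPoints
import Summits.ResolutionOfSingularities.ResolutionOfSingularities.Theorems.FrobeniusLadderFRationalResolutionFixedStratumCentre
import Summits.ResolutionOfSingularities.ResolutionOfSingularities.Theorems.FrobeniusLadderFRationalResolutionFixedStratumRadicalNearby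
import Summits.ResolutionOfSingularities.ResolutionOfSingularities.Theorems.FrobeniusLadderFRationalResolutionConeChartRecursion
import HarnessLib

/-!
# Crux `FrobeniusLadder.FRationalResolution` (stmt-ResolutionOfSingularities-15317), line `redirect`,
# stub `stub_diagonalizableQuotientResolution` — **THE GLOBAL ROUND AT A POINT: under the intrinsic blow-up
# `X₁ = Bl_{𝓘_{Sing X}} X` every singular point over a rank-2 stratum point `x` is the fixed point of a chart with
# `2 ≤ c ≤ d − 2`, with a new étale roof** (design C3 = the rank-2 stratum layer of the non-isolated case, L3-b core)

DATA (the invariant of lineage 2 along a stratum of any dimension, `…FixedStratumBlowupPoints`): a base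
`(A, P, φ, 𝔭)` log regular at `𝔭` and along the stratum below `𝔭`, rank bound `n − rk F_𝔭 ≤ 2`; a cone chart algebra
`(C, Q, χ)` in normal form `ℤF_𝔭 + {m u + l e : l ≥ 0, a l ≤ d m}`, `a < d`; a prime `𝔓` over `𝔭` containing
`χ(Q ∖ ℤF_𝔭)`; an étale roof `X ←ρ— Y —j↪ Spec C`, `j y = 𝔓`; and — the one hypothesis that makes the GLOBAL round
readable on the chart — the pointwise description of the singular locus on the image of the roof:
`¬ regular C_{j y'} ↔ I(𝔓, χ) ⊆ j y'` (`hSing`).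

**`exists_chart_of_singular_point`**: for ANY blowing up `π : X₁ → X` along `𝓘_{Sing X}` and any SINGULAR `x₁ ∈ X₁`
over `ρ y`, there are the Hirzebruch–Jung chain `s` of the round (centre `(χ s) = I(𝔓, χ)`), a chart `h ∈ s` with vertex
data `(v, x, c)`, `2 ≤ c ≤ d − 2`, a SINGULAR prime `𝔔` of `C_h = C[(χ s)/χ(h)]` over `𝔭` containing `χ_h(Q_h ∖ ℤF_𝔭)`,
and an étale roof `X₁ ←ρ'— Y' —j'↪ Spec C_h` through `x₁` with `j' y' = 𝔔` — the input of
`…FixedStratumNextRound.exists_fixedPrime_package_of_stratum` (measure `c ≤ d − 2`). Proof: the chain ideal is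
`I(𝔓, χ)` (`…FixedStratumCentre`), radical near `𝔓` (`…FixedStratumRadicalNearby`); shrink the roof to `D(g)`
(`…RoofShrink`); `Y₁ = X₁ ×_X Y'` maps étale to `X₁` and openly into `Bl_{(χ s)C_g}` (`…SingBlowupRoofPullback`), hence
into `Bl_{(χ s)}(Spec C)` (`…EtaleBlowupComparison`); classify the image point (`…FixedStratumBlowupPoints`); the roof at
`x₁` is `IsOpenImmersion.lift` through the chart (`…ConeChartRecursion.exists_roof_of_chart_point`).

Honest label: assembly toward ONE leaf stub (no stub, crux or summit closed). No definitions, no named facts, no sorry.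
[cite: Kato1994, (7.3), (10.1), (10.3)] [cite: GortzWedhorn2020, Prop. 13.91, (13.19) p. 415] [cite: Liu2002, §8.3.4]
-/

noncomputable section

-- single-problem summit: the doubled namespace component is forced
set_option linter.dupNamespace false

open CategoryTheory CategoryTheory.Limits AlgebraicGeometry TopologicalSpace
open IsLocalRing Literature.AlgebraicGeometry.Resolution Literature.AlgebraicGeometry.Resolution.LogChart
open Summit.ResolutionOfSingularities.ResolutionOfSingularities.Theorems.FRationalResolution

namespace Summit.ResolutionOfSingularities.ResolutionOfSingularities.Theorems.FRationalResolution.SingBlowupRound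

set_option maxHeartbeats 800000 in
/-- **The global round at a point.** See the module docstring.
[cite: Kato1994, (7.3), (10.1), (10.3)] [cite: GortzWedhorn2020, Prop. 13.91, (13.19) p. 415] -/
theorem exists_chart_of_singular_point {k : Type} [Field k] {X X₁ : Scheme.{0}} (f : X ⟶ Spec (.of k))
    [LocallyOfFiniteType f] {π : X₁ ⟶ X} (hπ : IsBlowup π (singularLocusIdeal X f))
    {A : Type} [CommRing A] [IsNoetherianRing A] {n : ℕ}
    {P : AddSubmonoid (Fin n → ℤ)} {φ : Multiplicative P →* A} {𝔭 : Ideal A} [𝔭.IsPrime]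
    {C : Type} [CommRing C] [Algebra A C] [IsNoetherianRing C] {Q : AddSubmonoid (Fin n → ℤ)}
    {χ : Multiplicative Q →* C} {u e : Fin n → ℤ} {a d : ℕ} (had : a < d) (hP : P.FG)
    (hsat : ∀ (w : Fin n → ℤ) (k : ℕ), 0 < k → k • w ∈ P → w ∈ P)
    (hspanP : Submodule.span ℤ (P : Set (Fin n → ℤ)) = ⊤) (hreg : IsLogRegularAt P φ 𝔭) (hPQ : P ≤ Q)
    (hχ : ∀ p : P, χ (Multiplicative.ofAdd ⟨(p : Fin n → ℤ), hPQ p.2⟩) =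
      algebraMap A C (φ (Multiplicative.ofAdd p)))
    (hgen : Algebra.adjoin A (Set.range χ) = ⊤)
    (hD : ∀ q ∈ Q, ∃ p ∈ P, q + p ∈ P)
    (hK : ∀ a : A, algebraMap A C a = 0 → ∃ p : P, φ (Multiplicative.ofAdd p) * a = 0)
    (hΩ : ∀ (K : Type) [Field K] (g : A →+* K), (∀ p : P, g (φ (Multiplicative.ofAdd p)) ≠ 0) →
      ∃ ω : C →+* K, ω.comp (algebraMap A C) = g)
    (hQfg : Q.FG)
    (hQ : ∀ w, w ∈ Q ↔ ∃ g ∈ Submodule.span ℤ (faceMonoid P φ 𝔭 : Set (Fin n → ℤ)), ∃ m l : ℤ,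
      0 ≤ l ∧ (a : ℤ) * l ≤ (d : ℤ) * m ∧ w = g + m • u + l • e)
    (hind : ∀ g ∈ Submodule.span ℤ (faceMonoid P φ 𝔭 : Set (Fin n → ℤ)), ∀ m l : ℤ,
      g + m • u + l • e = 0 → m = 0 ∧ l = 0)
    (hspan : ∀ w : Fin n → ℤ, ∃ g ∈ Submodule.span ℤ (faceMonoid P φ 𝔭 : Set (Fin n → ℤ)),
      ∃ m l : ℤ, w = g + m • u + l • e)
    (hreg' : ∀ (𝔮 : Ideal A) [𝔮.IsPrime], 𝔮 ≤ 𝔭 → ideal P φ 𝔭 ≤ 𝔮 → IsLogRegularAt P φ 𝔮)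
    (hrank : n - Module.finrank ℤ (Submodule.span ℤ (faceMonoid P φ 𝔭 : Set (Fin n → ℤ))) ≤ 2)
    (𝔓 : Ideal C) [𝔓.IsPrime] (h𝔓A : 𝔓.comap (algebraMap A C) = 𝔭)
    (h𝔓q : ∀ q : Q, (q : Fin n → ℤ) ∉ Submodule.span ℤ (faceMonoid P φ 𝔭 : Set (Fin n → ℤ)) →
      χ (Multiplicative.ofAdd q) ∈ 𝔓)
    {Y : Scheme.{0}} (ρ : Y ⟶ X) [Etale ρ] (j : Y ⟶ Spec (.of C)) [IsOpenImmersion j] (y : Y)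
    (hjy : (j y).asIdeal = 𝔓)
    (hSing : ∀ y' : Y, ¬ IsRegularLocalRing (Localization.AtPrime (j y').asIdeal) ↔ ideal Q χ 𝔓 ≤ (j y').asIdeal) :
    ∀ x₁ : X₁, π x₁ = ρ y → x₁ ∉ Scheme.regularLocus X₁ →
      ∃ s : Set (Fin n → ℤ), s.Finite ∧ s ⊆ Q ∧
        (∀ h ∈ s, h ∉ Submodule.span ℤ (faceMonoid P φ 𝔭 : Set (Fin n → ℤ))) ∧
        (∀ q ∈ Q, q ∉ Submodule.span ℤ (faceMonoid P φ 𝔭 : Set (Fin n → ℤ)) → ∃ h ∈ s, q - h ∈ Q) ∧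
        ∃ (h : Fin n → ℤ) (hhQ : h ∈ Q) (_ : h ∈ s) (v x : Fin n → ℤ) (c : ℕ), 2 ≤ c ∧ c + 2 ≤ d ∧
          (∀ w, w ∈ blowupChartMonoid Q {q : Q | (q : Fin n → ℤ) ∈ s} ⟨h, hhQ⟩ ↔
            ∃ g ∈ Submodule.span ℤ (faceMonoid P φ 𝔭 : Set (Fin n → ℤ)), ∃ m l : ℤ,
              0 ≤ m ∧ 0 ≤ m + (c : ℤ) * l ∧ w = g + m • v + l • x) ∧
          (∀ g ∈ Submodule.span ℤ (faceMonoid P φ 𝔭 : Set (Fin n → ℤ)), ∀ m l : ℤ,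
            g + m • v + l • x = 0 → m = 0 ∧ l = 0) ∧
          (∀ w : Fin n → ℤ, ∃ g ∈ Submodule.span ℤ (faceMonoid P φ 𝔭 : Set (Fin n → ℤ)),
            ∃ m l : ℤ, w = g + m • v + l • x) ∧
          ∃ (𝔔 : Ideal (blowupAlgebra (Ideal.span ((fun q : Q => χ (Multiplicative.ofAdd q)) ''
              {q : Q | (q : Fin n → ℤ) ∈ s})) (χ (Multiplicative.ofAdd ⟨h, hhQ⟩)))) (_ : 𝔔.IsPrime),
            𝔔.comap (algebraMap A _) = 𝔭 ∧
            (∀ qq : blowupChartMonoid Q {q : Q | (q : Fin n → ℤ) ∈ s} ⟨h, hhQ⟩,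
              (qq : Fin n → ℤ) ∉ Submodule.span ℤ (faceMonoid P φ 𝔭 : Set (Fin n → ℤ)) →
                blowupChart Q χ {q : Q | (q : Fin n → ℤ) ∈ s} ⟨h, hhQ⟩ (Multiplicative.ofAdd qq) ∈ 𝔔) ∧
            ¬ IsRegularLocalRing (Localization.AtPrime 𝔔) ∧
            ∃ (Y' : Scheme.{0}) (ρ' : Y' ⟶ X₁) (_ : Etale ρ')
              (j' : Y' ⟶ Spec (.of (blowupAlgebra (Ideal.span ((fun q : Q => χ (Multiplicative.ofAdd q)) ''
                {q : Q | (q : Fin n → ℤ) ∈ s})) (χ (Multiplicative.ofAdd ⟨h, hhQ⟩)))))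
              (_ : IsOpenImmersion j') (y' : Y'), ρ' y' = x₁ ∧ (j' y').asIdeal = 𝔔 := by
  intro x₁ hx₁ hx₁sing
  classical
  -- (1) the ring-level round: the chain `s`, `J = (χ s) = I(𝔓, χ)`, the points of `Bl_J(Spec C)` over `𝔭`
  obtain ⟨s, hsfin, hsQ, hsL, hsgen, hcl⟩ := FixedStratumBlowupPoints.stalk_regular_or_fixedPrime_of_stratum had
    hP hsat hspanP hreg hPQ hχ hgen hD hK hΩ hQfg hQ hind hspan hreg' hrank
  set J : Ideal C := Ideal.span ((fun q : Q => χ (Multiplicative.ofAdd q)) '' {q : Q | (q : Fin n → ℤ) ∈ s})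
    with hJdef
  have hJeq : J = ideal Q χ 𝔓 := FixedStratumCentre.span_chain_eq_ideal hPQ hχ hsQ hsL hsgen h𝔓A h𝔓q
  -- (2) `J` is radical near `𝔓`
  have hd : 0 < d := by omega
  have hS : ∀ q₁ ∈ Q, ∀ q₂ ∈ Q, q₁ + q₂ ∈ Submodule.span ℤ (faceMonoid P φ 𝔭 : Set (Fin n → ℤ)) →
      q₁ ∈ Submodule.span ℤ (faceMonoid P φ 𝔭 : Set (Fin n → ℤ)) := ConeChainCharts.cone_face hd hQ hind
  have hH : ∀ q ∈ Q, ∀ p ∈ P, q + p ∈ Submodule.span ℤ (faceMonoid P φ 𝔭 : Set (Fin n → ℤ)) →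
      q ∈ Submodule.span ℤ (faceMonoid P φ 𝔭 : Set (Fin n → ℤ)) :=
    fun q hq p hp hqp => hS q hq p (hPQ hp) hqp
  have hrad𝔓 : (J.map (algebraMap C (Localization.AtPrime 𝔓))).IsRadical :=
    (FixedStratumCentre.isRadical_map_span_chain hP hsat hreg hreg' hPQ hχ hgen hD hK hS hH hsQ hsL hsgen
      h𝔓A h𝔓q).2
  obtain ⟨g, hg𝔓, hradg⟩ := FixedStratumRadicalNearby.exists_isRadical_map_away J 𝔓 hrad𝔓
  -- (3) shrink the roof to `D(g)`
  have hgy : g ∉ (j y).asIdeal := by rw [hjy]; exact hg𝔓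
  obtain ⟨Y', ρ', _, j', _, ι, _, y', hρ', hj', hιy', hcomap⟩ := RoofShrink.exists_roof_shrink ρ j g y hgy
  have hZ' : ∀ y'' : Y', ¬ IsRegularLocalRing (Localization.AtPrime (j' y'').asIdeal) ↔
      J.map (algebraMap C (Localization.Away g)) ≤ (j' y'').asIdeal := by
    refine RoofShrink.singular_iff_le_of_shrink g J j' fun y'' => ?_
    have key : ∀ (I : Ideal C) (hI : I.IsPrime), I = (j (ι y'')).asIdeal →
        (¬ IsRegularLocalRing (Localization.AtPrime I) ↔ J ≤ I) := by
      rintro I hI rfl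
      rw [hJeq]
      exact hSing (ι y'')
    exact key _ _ (hcomap y'')
  -- (4) `Y₁ = X₁ ×_X Y'`: étale over `X₁`, open in `Bl_{J C_g}`, hence in `Bl_J(Spec C)`
  obtain ⟨Y₁, Φ₁, _, Φ₂, _, ρ₁, hΦ₁π, hΦ₂π, hregiff, hsurj⟩ :=
    SingBlowupRoofPullback.exists_roof_pullback f hπ ρ' j' (J.map (algebraMap C (Localization.Away g))) hradg hZ'
  obtain ⟨Φ₃, hΦ₃oi, hΦ₃π, hΦ₃reg, -⟩ :=
    EtaleBlowupComparison.exists_openImmersion_comparison (algebraMap C (Localization.Away g)) J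
  haveI := hΦ₃oi
  -- (5) the point `y₁` of `Y₁` over `(x₁, y')` and its image `p'` in `Bl_J(Spec C)`, which lies over `𝔓`
  have hx₁' : π x₁ = ρ' y' := by rw [hρ', Scheme.Hom.comp_apply, hιy']; exact hx₁
  obtain ⟨y₁, hy₁x, hy₁y⟩ := hsurj x₁ y' hx₁'
  have hp'π : (affineBlowup.π J (Φ₃ (Φ₂ y₁))).asIdeal = 𝔓 := by
    have h1 : affineBlowup.π J (Φ₃ (Φ₂ y₁)) =
        Spec.map (CommRingCat.ofHom (algebraMap C (Localization.Away g))) (j' y') := by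
      rw [← Scheme.Hom.comp_apply, hΦ₃π, Scheme.Hom.comp_apply, ← Scheme.Hom.comp_apply Φ₂, hΦ₂π,
        Scheme.Hom.comp_apply, hy₁y]
    rw [h1, ← hjy, ← hιy', ← hcomap y']
    rfl
  have hp'A : (affineBlowup.π J (Φ₃ (Φ₂ y₁))).asIdeal.comap (algebraMap A C) = 𝔭 := by rw [hp'π, h𝔓A]
  -- (6) classification: `p'` is not regular, so it is the image of a singular fixed prime with `2 ≤ c ≤ d - 2`
  rcases hcl (Φ₃ (Φ₂ y₁)) hp'A with hregp | ⟨h, hhQ, hhs, v, x, c, hc2, hcd, hQh, hindvx, hspanvx, q, 𝔔, h𝔔,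
      hpq, hmemq, h𝔔A, h𝔔q, hsing⟩
  · exact absurd ((hregiff y₁).mpr ((hΦ₃reg (Φ₂ y₁)).mpr hregp)) (hy₁x ▸ hx₁sing)
  · -- (7) the étale roof at `x₁` through the chart at `h`
    have hχh : χ (Multiplicative.ofAdd ⟨h, hhQ⟩) ∈ J :=
      Ideal.subset_span (Set.mem_image_of_mem (fun q : Q => χ (Multiplicative.ofAdd q))
        (show (⟨h, hhQ⟩ : Q) ∈ {q : Q | (q : Fin n → ℤ) ∈ s} from hhs))
    have hpq' : Proj.awayι (reesGrading J) (reesT (χ (Multiplicative.ofAdd ⟨h, hhQ⟩)) hχh)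
        (reesT_mem (χ (Multiplicative.ofAdd ⟨h, hhQ⟩)) hχh) one_pos q = (Φ₂ ≫ Φ₃) y₁ := by
      rw [Scheme.Hom.comp_apply]; exact hpq
    obtain ⟨Y'', ρ'', _, j'', _, y₁', hρ''y, hj''y⟩ :=
      ConeChartRecursion.exists_roof_of_chart_point J _ hχh (Φ₂ ≫ Φ₃) Φ₁ y₁ q 𝔔 hpq' hmemq
    refine ⟨s, hsfin, hsQ, hsL, hsgen, h, hhQ, hhs, v, x, c, hc2, hcd, hQh, hindvx, hspanvx, 𝔔, h𝔔, h𝔔A, h𝔔q,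
      hsing, Y'', ρ'', inferInstance, j'', inferInstance, y₁', ?_, hj''y⟩
    rw [hρ''y, hy₁x]

end Summit.ResolutionOfSingularities.ResolutionOfSingularities.Theorems.FRationalResolution.SingBlowupRound

end
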